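import Summits.CriticalPhenomena.PercolationContinuityZ3.Theorems.Transplant.AutChartOrbitsCylinders
import Summits.CriticalPhenomena.PercolationContinuityZ3.Theorems.Transplant.AutChartQuasiTransitive
import Summits.CriticalPhenomena.PercolationContinuityZ3.Theorems.Transplant.AutRelMilnorKernelTwo
import Summits.CriticalPhenomena.PercolationContinuityZ3.Theorems.Transplant.SkelFrmScaledAlignedHoldsAll
import HarnessLib

/-!
# INPUT(G) WITH FINITELY MANY ORBITS: `θ_v(p_c) = 0` on every connected locally finite graph with a group of automorphisms acting with FINITELY MANY
# ORBITS, a homomorphism to `ℤ²` killing a vertex stabiliser, and single-edge axis steps on a transversal — UNCONDITIONAL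

builds on p205010 (kernel theorem, internal audit signed; external expert review pending).  Lane `prim-bschramm`, seat `prim-bschramm-p3` gen 28 (design
owner; NEXT-SCOPE (N3), the action / orbit side of the rung after U_s).  Helper file (`--supports stmt-CriticalPhenomena-4575 --as helper`); PROOFS ONLY
over «AutChartOrbitsDatum» / «AutChartOrbitsCylinders» (this seat) and gen-1 g3's aligned multi-type scaled node «SkelFrmScaledAlignedHoldsAll» (p490798).
No `@[conjecture]` is declared, edited or claimed; nothing is claimed about non-aligned carriers, path-steps, chartless classes, the end state or Conj. 4
in general.

THE THEOREM (`AutChart.criticalContinuity_of_finite_orbits`).  `G` connected, locally finite; `A` acting on `V(G)` by automorphisms with FINITELY MANY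
ORBITS, read on a transversal `reps` (stabilisers ARBITRARY); `c : A → ℤ²` a homomorphism killing the stabiliser of ONE vertex; a scale `N ≥ 1` such that
every edge `r ∼ a • r'` between (translates of) representatives has `‖c a‖_∞ ≤ N` and every representative has the four neighbours `a • r'` with
`c a = ± N eᵢ`.  Then `θ_v(p_c(G)) = 0` at EVERY vertex.  p4 gen 25's «AutChartCriticalContinuity» is the case of ONE orbit (there the steps and the
bound come for free from a rank-two character by max-area re-basing; with several orbits they do not — «AutChartOrbitsDatum» header).
THE PROOF.  (§1) a character killing ONE stabiliser kills EVERY stabiliser (`h ∈ Stab(v)` moves `t` inside the finite ball `B(v, d(v,t))`, so two powers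
of `h` agree on `t` and a nonzero multiple of `c h` vanishes in the torsion-free `ℤ²`); (§2) finitely many orbits make `A = ⟨T ∪ Stab(r)⟩` with `T` FINITE
for every base `r` (walk induction through the transversal) and, OFF exponential growth, balls about every vertex subexponential on every linear scale
(volumes at `x` are volumes at `typ x`, within `D_reps` of any base); so the relative Milnor kernel lemma «AutRelMilnorKernelTwo» bounds the kernel
displacement at every base and **the orbit datum EXISTS** (`exists_orbitDatum`); (§3) ON exponential growth Hutchcroft (quasi-transitivity from the
finitely many orbits), OFF it `OrbitDatum.skeleton` is a multi-type `PlanarSkeletonFrmScaled` with `L = N` and chart-aligned base types, and p490798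
`frmScaledAligned_criticalContinuity_holds` concludes.  Also: `p_c < 1` (p4-g25 «AutChartQuasiTransitive», unconditional) ⟹ Conj. 4 in its own shape on
this class (`conj4_of_finite_orbits`), and the drop form.
[cite: BenjaminiSchramm1996, Conj. 4; §2 (almost transitive / quasi-transitive graphs)] [cite: Hutchcroft2016, Thm. 1.1] [cite: MilnorSolvableGrowth1968, Lemma 1]
[cite: KozmaNitzan2024, §1 p. 2 (approach 1); §4 p. 16 (Lemma 8)] [cite: MartineauTassion2017, §3.2 (good coordinates)]
-/

noncomputable section

namespace Summit.CriticalPhenomena.PercolationContinuityZ3.Theorems.Transplant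

open SimpleGraph Filter Literature.Barriers.CriticalPhenomena Literature.Probability.LatticeModels Literature.Probability.Percolation
open scoped Classical

namespace AutChart

variable {V : Type} {G : SimpleGraph V} {A : Type} [Group A] [MulAction A V]

/-! ## §1 A character killing one stabiliser kills every stabiliser -/

/-- **A character killing the stabiliser of ONE vertex kills the stabiliser of EVERY vertex** of a connected locally finite graph acted on by automorphisms:
`h ∈ Stab(v)` moves `t` inside the finite ball `B(v, d(v,t))`, so `hⁱ • t = hʲ • t` for some `i ≠ j`, and `(j − i) · c h = 0` in the torsion-free `ℤ²`.
[cite: BenjaminiSchramm1996, §2 (almost transitive graphs)] -/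
theorem map_stabilizer_eq_one_of_one [G.LocallyFinite] (hact : IsActionByAut G A) (hc : G.Connected) (c : A →* Multiplicative (Site 2)) {t : V}
    (hstab : ∀ h ∈ MulAction.stabilizer A t, c h = 1) (v : V) : ∀ h ∈ MulAction.stabilizer A v, c h = 1 := by
  intro h hh
  obtain ⟨w⟩ := hc.preconnected v t
  set n := w.length with hn
  have ht : t ∈ graphBall G v n := ⟨w, le_rfl⟩
  have hpow : ∀ i : ℕ, (h ^ i) • t ∈ graphBall G v n := by
    intro i
    have hv : (h ^ i) • v = v := MulAction.mem_stabilizer_iff.1 (pow_mem hh i)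
    have := (smul_mem_graphBall_iff hact (h ^ i) (x := v) (y := t) (n := n)).2 ht
    rwa [hv] at this
  haveI : Finite (graphBall G v n) := (graphBall_finite G v n).to_subtype
  obtain ⟨i, j, hij, he⟩ := Finite.exists_ne_map_eq_of_infinite (fun i : ℕ => (⟨(h ^ i) • t, hpow i⟩ : graphBall G v n))
  have he' : (h ^ i) • t = (h ^ j) • t := congrArg Subtype.val he
  have hst : (h ^ i)⁻¹ * h ^ j ∈ MulAction.stabilizer A t := by
    rw [MulAction.mem_stabilizer_iff, mul_smul, ← he', inv_smul_smul]
  have h1 := hstab _ hst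
  rw [map_mul, map_inv, inv_mul_eq_one, map_pow, map_pow] at h1
  -- `(c h)^i = (c h)^j` with `i ≠ j` in the torsion-free `ℤ²`
  have h2 : i • Multiplicative.toAdd (c h) = j • Multiplicative.toAdd (c h) := by
    rw [← toAdd_pow, ← toAdd_pow, h1]
  rw [← ofAdd_toAdd (c h), ← ofAdd_zero]
  congr 1
  funext k
  have hk := congrFun h2 k
  rw [Pi.smul_apply, Pi.smul_apply, nsmul_eq_mul, nsmul_eq_mul] at hk
  have h3 : ((i : ℤ) - j) * Multiplicative.toAdd (c h) k = 0 := by rw [sub_mul, hk, sub_self]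
  rcases mul_eq_zero.1 h3 with h0 | h0
  · exact absurd (by exact_mod_cast (sub_eq_zero.1 h0) : i = j) hij
  · exact h0

/-! ## §2 Finitely many orbits: finite generation relative to a stabiliser, subexponential balls, and the datum -/

section Construct

variable [G.LocallyFinite] {reps : Finset V}

/-- **With finitely many orbits, the sections of the neighbours of the representatives, together with `Stab(r)`, generate `A`** — for every base `r` of the
transversal (walk induction from `r`: along an edge `x ∼ y` with `x = b • typ x`, the vertex `b⁻¹ • y` is a neighbour of a representative, and its section
carries `typ y` to it). [cite: BenjaminiSchramm1996, §2 (almost transitive graphs)] -/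
theorem closure_osec_eq_top (hact : IsActionByAut G A) (hc : G.Connected) (hcover : ∀ w : V, ∃ a : A, ∃ r ∈ reps, a • r = w)
    (htrans : ∀ r ∈ reps, ∀ r' ∈ reps, ∀ a : A, a • r = r' → r = r') {r : V} (hr : r ∈ reps) :
    Subgroup.closure (↑(reps.biUnion fun ρ => (G.neighborFinset ρ).image (osec hcover)) ∪ (↑(MulAction.stabilizer A r) : Set A)) = ⊤ := by
  set T := reps.biUnion fun ρ => (G.neighborFinset ρ).image (osec hcover) with hT
  set H := Subgroup.closure (↑T ∪ (↑(MulAction.stabilizer A r) : Set A)) with hH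
  have key : ∀ (x y : V) (p : G.Walk x y), y = r → ∃ b ∈ H, b • otyp hcover x = x := by
    intro x y p
    induction p with
    | nil => intro hy; exact ⟨1, one_mem _, by rw [one_smul, hy, otyp_of_mem hcover htrans hr]⟩
    | @cons x z y hxz p ih =>
      intro hy
      obtain ⟨b, hb, hbz⟩ := ih hy
      -- `b⁻¹ • x` is a neighbour of the representative `otyp z`
      have hadj : G.Adj (otyp hcover z) (b⁻¹ • x) := by
        have h1 : G.Adj (b⁻¹ • x) (b⁻¹ • z) := (hact b⁻¹ x z).2 hxz
        rw [← hbz, inv_smul_smul] at h1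
        exact h1.symm
      have hmem : osec hcover (b⁻¹ • x) ∈ T :=
        Finset.mem_biUnion.2 ⟨otyp hcover z, otyp_mem hcover z, Finset.mem_image_of_mem _ ((G.mem_neighborFinset _ _).2 hadj)⟩
      refine ⟨b * osec hcover (b⁻¹ • x), mul_mem hb (Subgroup.subset_closure (Set.mem_union_left _ (Finset.mem_coe.2 hmem))), ?_⟩
      rw [← otyp_smul hcover htrans b⁻¹ x, mul_smul, osec_smul, smul_inv_smul]
  refine (Subgroup.eq_top_iff' H).2 fun a₀ => ?_
  obtain ⟨p⟩ := hc.preconnected (a₀ • r) r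
  obtain ⟨b, hb, hbt⟩ := key _ _ p rfl
  rw [otyp_smul hcover htrans a₀ r, otyp_of_mem hcover htrans hr] at hbt
  have hσ : b⁻¹ * a₀ ∈ MulAction.stabilizer A r := by
    rw [MulAction.mem_stabilizer_iff, mul_smul, ← hbt, inv_smul_smul]
  have e : a₀ = b * (b⁻¹ * a₀) := by group
  rw [e]
  exact mul_mem hb (Subgroup.subset_closure (Set.mem_union_right _ hσ))

/-- **No exponential growth ⟹ `∀ R ≥ 1 ∃ m, |B(r, mR)| < 2^m`** at EVERY vertex `r`, for an action with finitely many orbits (the ball about `x` is the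
translate of the ball about `typ x`, which contains the ball about `r` of radius smaller by `d(typ x, r) ≤ D`). [cite: Hutchcroft2016, §1 (exponential growth)]
[cite: MilnorSolvableGrowth1968, p. 447] -/
theorem subexp_of_finite_orbits (hact : IsActionByAut G A) (hc : G.Connected) (hcover : ∀ w : V, ∃ a : A, ∃ r ∈ reps, a • r = w)
    (hG : ¬ HasExponentialGrowth G) (r : V) : ∀ R : ℕ, 1 ≤ R → ∃ m : ℕ, ballVolume G r (m * R) < 2 ^ m := by
  -- a common bound `D` for the distances from the representatives to `r`
  have hdist : ∀ ρ : V, ∃ d : ℕ, r ∈ graphBall G ρ d := fun ρ => by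
    obtain ⟨w⟩ := hc.preconnected ρ r
    exact ⟨w.length, w, le_rfl⟩
  choose d hd using hdist
  set D := reps.sup d with hD_def
  intro R hR
  by_contra hno
  push Not at hno
  refine hG (Milnor.hasExponentialGrowth_of_two_pow_le G (R := R + D) (by omega) fun x m => ?_)
  obtain ⟨a, ρ, hρ, rfl⟩ := hcover x
  rcases Nat.eq_zero_or_pos m with rfl | hm
  · rw [pow_zero, Nat.one_le_iff_ne_zero, Ne, ballVolume, Set.ncard_eq_zero (graphBall_finite G _ _)]
    exact fun h => (Set.eq_empty_iff_forall_notMem.1 h) _ (mem_graphBall_self G _ _)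
  · have hdρ : d ρ ≤ D := Finset.le_sup (f := d) hρ
    calc 2 ^ m ≤ ballVolume G r (m * R) := hno m
      _ ≤ ballVolume G ρ (d ρ + m * R) :=
          Set.ncard_le_ncard (fun y hy => mem_graphBall_add G (hd ρ) hy) (graphBall_finite G _ _)
      _ ≤ ballVolume G ρ (m * (R + D)) := Milnor.ballVolume_mono G ρ (by nlinarith)
      _ = ballVolume G (a • ρ) (m * (R + D)) := by rw [← smulIso_apply hact a ρ, ballVolume_map_eq]

/-- **THE ORBIT DATUM EXISTS**: an action by automorphisms with finitely many orbits (transversal `reps`) of a connected locally finite graph WITHOUT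
exponential growth, a character `c : A → ℤ²` killing one stabiliser, and a scale `N ≥ 1` with `‖c a‖_∞ ≤ N` on the edges at the representatives and EXACT
single-edge axis steps `± N eᵢ` at every representative, give an `OrbitDatum` — the kernel displacement bound at every base by the relative Milnor kernel
lemma (rank two). [cite: MilnorSolvableGrowth1968, Lemma 1] [cite: BenjaminiSchramm1996, §2 (almost transitive graphs)] [cite: KozmaNitzan2024, §4 p. 16 (Lemma 8)] -/
theorem exists_orbitDatum (hact : IsActionByAut G A) (hc : G.Connected) (reps : Finset V)
    (htrans : ∀ r ∈ reps, ∀ r' ∈ reps, ∀ a : A, a • r = r' → r = r') (hcover : ∀ w : V, ∃ a : A, ∃ r ∈ reps, a • r = w)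
    (c : A →* Multiplicative (Site 2)) {t : V} (hstab : ∀ h ∈ MulAction.stabilizer A t, c h = 1) (N : ℕ) (hN : 1 ≤ N)
    (hlip : ∀ r ∈ reps, ∀ r' ∈ reps, ∀ a : A, G.Adj r (a • r') → ∀ i : Fin 2, |Multiplicative.toAdd (c a) i| ≤ N)
    (hstep : ∀ r ∈ reps, ∀ (i : Fin 2) (σ : ℤˣ), ∃ (a : A) (r' : V), r' ∈ reps ∧ G.Adj r (a • r') ∧
      Multiplicative.toAdd (c a) = Pi.single i ((N : ℤ) * σ))
    (hG : ¬ HasExponentialGrowth G) : Nonempty (OrbitDatum G A) := by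
  have hstab' : ∀ (v : V), ∀ h ∈ MulAction.stabilizer A v, c h = 1 := map_stabilizer_eq_one_of_one hact hc c hstab
  -- the kernel displacement bound at each base
  have hker : ∀ r ∈ reps, ∃ m : ℕ, c.ker = Subgroup.closure {g | g ∈ c.ker ∧ g • r ∈ graphBall G r m} := fun r hr =>
    AutMilnor.ker_eq_closure_bounded hact hc r (subexp_of_finite_orbits hact hc hcover hG r) _
      (closure_osec_eq_top hact hc hcover htrans hr) c (hstab' r)
  choose! mb hmb using hker
  refine ⟨{ act := hact, conn := hc, reps := reps, cover := hcover, trans := htrans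
            ψ := fun a => Multiplicative.toAdd (c a)
            ψ_mul := fun a b => by simp only [map_mul, toAdd_mul]
            ψ_stab := fun v h hh => by simp only [hstab' v h hh, toAdd_one]
            N := N, one_le_N := hN, lipN := hlip, step := hstep
            m := reps.sup mb
            ker_gen := ?_ }⟩
  intro r hr k hk
  have hk1 : k ∈ c.ker := by
    rw [MonoidHom.mem_ker, ← ofAdd_toAdd (c k), show Multiplicative.toAdd (c k) = 0 from hk, ofAdd_zero]
  have hsub : {g | g ∈ c.ker ∧ g • r ∈ graphBall G r (mb r)} ⊆ {g : A | Multiplicative.toAdd (c g) = 0 ∧ g • r ∈ graphBall G r (reps.sup mb)} := by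
    rintro g ⟨hg, hgm⟩
    refine ⟨?_, graphBall_mono _ _ (Finset.le_sup (f := mb) hr) hgm⟩
    rw [MonoidHom.mem_ker] at hg
    rw [hg, toAdd_one]
  exact Subgroup.closure_mono hsub ((hmb r hr).le hk1)

omit [G.LocallyFinite] in
/-- **Finitely many orbits make `G` quasi-transitive** (`V₀ := reps`; the inverse section carries `v` to its type). [cite: Hutchcroft2016, §1 (finitely many Aut(G)-orbits)] -/
theorem isQuasiTransitive_of_finite_orbits (hact : IsActionByAut G A) (reps : Finset V) (hcover : ∀ w : V, ∃ a : A, ∃ r ∈ reps, a • r = w) :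
    IsQuasiTransitive G :=
  ⟨reps, fun v => ⟨smulIso hact (osec hcover v)⁻¹, by
    rw [smulIso_apply, inv_smul_eq_iff.2 (osec_smul hcover v).symm]
    exact otyp_mem hcover v⟩⟩

end Construct

/-! ## §3 THE THEOREM: finitely many orbits, a character killing a stabiliser, single-edge axis steps on a transversal ⟹ `θ_v(p_c) = 0` -/

variable [G.LocallyFinite]

/-- **THEOREM (UNCONDITIONAL) — INPUT(G) WITH FINITELY MANY ORBITS.**  `G` connected and locally finite; `A` acting on `V(G)` by automorphisms with FINITELY
MANY ORBITS, `reps` a transversal (stabilisers arbitrary); `c : A → ℤ²` a homomorphism killing the stabiliser of one vertex; a scale `N ≥ 1` such that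
`‖c a‖_∞ ≤ N` whenever `r ∼ a • r'` (`r, r' ∈ reps`) and every representative `r` has, for each axis `i` and sign `σ`, a neighbour `a • r'` (`r' ∈ reps`) with
`c a = N σ eᵢ` ⟹ **`θ_v(p_c(G)) = 0` at every vertex.**  ON exponential growth of `G`: Hutchcroft.  OFF it: the orbit datum exists (`exists_orbitDatum`),
`G` carries the multi-type scaled skeleton `OrbitDatum.skeleton` (`L = N`, base types chart-aligned), and the aligned multi-type scaled node (gen-1 g3,
p490798) applies.  One orbit = p4 gen 25's `AutChart.criticalContinuity` (now `conj4_holds`), where the steps and the bound are automatic.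
builds on p205010 (kernel theorem, internal audit signed; external expert review pending). [cite: BenjaminiSchramm1996, Conj. 4; §2 (quasi-transitive graphs)]
[cite: Hutchcroft2016, Thm. 1.1] [cite: MilnorSolvableGrowth1968, Lemma 1] [cite: KozmaNitzan2024, §4 p. 16 (Lemma 8)] -/
theorem criticalContinuity_of_finite_orbits (hact : IsActionByAut G A) (hc : G.Connected) (reps : Finset V)
    (htrans : ∀ r ∈ reps, ∀ r' ∈ reps, ∀ a : A, a • r = r' → r = r') (hcover : ∀ w : V, ∃ a : A, ∃ r ∈ reps, a • r = w)
    (c : A →* Multiplicative (Site 2)) {t : V} (hstab : ∀ h ∈ MulAction.stabilizer A t, c h = 1) (N : ℕ) (hN : 1 ≤ N)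
    (hlip : ∀ r ∈ reps, ∀ r' ∈ reps, ∀ a : A, G.Adj r (a • r') → ∀ i : Fin 2, |Multiplicative.toAdd (c a) i| ≤ N)
    (hstep : ∀ r ∈ reps, ∀ (i : Fin 2) (σ : ℤˣ), ∃ (a : A) (r' : V), r' ∈ reps ∧ G.Adj r (a • r') ∧
      Multiplicative.toAdd (c a) = Pi.single i ((N : ℤ) * σ))
    (v : V) : theta G v (criticalProbIOf G v) = 0 := by
  by_cases hG : HasExponentialGrowth G
  · exact Hutchcroft2016_noPercolationAtCriticality_holds G hc (isQuasiTransitive_of_finite_orbits hact reps hcover) hG v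
  · obtain ⟨D⟩ := exists_orbitDatum hact hc reps htrans hcover c hstab N hN hlip hstep hG
    exact frmScaledAligned_criticalContinuity_holds G D.skeleton D.skeleton_L_le_N D.skeleton_aligned v

/-- … and `θ_v(p) = 0` for every `p ≤ p_c`. builds on p205010 (kernel theorem, internal audit signed; external expert review pending).
[cite: BenjaminiSchramm1996, Conj. 4; §2] -/
theorem theta_eq_zero_of_le_of_finite_orbits (hact : IsActionByAut G A) (hc : G.Connected) (reps : Finset V)
    (htrans : ∀ r ∈ reps, ∀ r' ∈ reps, ∀ a : A, a • r = r' → r = r') (hcover : ∀ w : V, ∃ a : A, ∃ r ∈ reps, a • r = w)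
    (c : A →* Multiplicative (Site 2)) {t : V} (hstab : ∀ h ∈ MulAction.stabilizer A t, c h = 1) (N : ℕ) (hN : 1 ≤ N)
    (hlip : ∀ r ∈ reps, ∀ r' ∈ reps, ∀ a : A, G.Adj r (a • r') → ∀ i : Fin 2, |Multiplicative.toAdd (c a) i| ≤ N)
    (hstep : ∀ r ∈ reps, ∀ (i : Fin 2) (σ : ℤˣ), ∃ (a : A) (r' : V), r' ∈ reps ∧ G.Adj r (a • r') ∧
      Multiplicative.toAdd (c a) = Pi.single i ((N : ℤ) * σ))
    (v : V) {p : unitInterval} (hp : (p : ℝ) ≤ criticalProb G v) : theta G v p = 0 := by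
  haveI : Countable V := countable_of_connected_of_locallyFinite G hc v
  rcases hp.lt_or_eq with hlt | heq
  · exact theta_eq_zero_of_lt_criticalProb_holds G v p hlt
  · have e : p = criticalProbIOf G v := Subtype.ext heq
    rw [e]
    exact criticalContinuity_of_finite_orbits hact hc reps htrans hcover c hstab N hN hlip hstep v

/-- **Conj. 4 in its own shape on this class**: `p_c(G) < 1` (p4 gen 25's `criticalProb_lt_one_of_finite_orbits`, from the rank-two pair of step movers at a
representative) AND `θ_v(p_c) = 0`, at every vertex — UNCONDITIONAL. builds on p205010 (kernel theorem, internal audit signed; external expert review pending).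
[cite: BenjaminiSchramm1996, Conj. 4; §2 Conj. 1] [cite: LyonsPeres2016, §7.4 Thm. 7.15] -/
theorem conj4_of_finite_orbits (hact : IsActionByAut G A) (hc : G.Connected) (reps : Finset V)
    (htrans : ∀ r ∈ reps, ∀ r' ∈ reps, ∀ a : A, a • r = r' → r = r') (hcover : ∀ w : V, ∃ a : A, ∃ r ∈ reps, a • r = w)
    (c : A →* Multiplicative (Site 2)) {t : V} (hstab : ∀ h ∈ MulAction.stabilizer A t, c h = 1) (N : ℕ) (hN : 1 ≤ N)
    (hlip : ∀ r ∈ reps, ∀ r' ∈ reps, ∀ a : A, G.Adj r (a • r') → ∀ i : Fin 2, |Multiplicative.toAdd (c a) i| ≤ N)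
    (hstep : ∀ r ∈ reps, ∀ (i : Fin 2) (σ : ℤˣ), ∃ (a : A) (r' : V), r' ∈ reps ∧ G.Adj r (a • r') ∧
      Multiplicative.toAdd (c a) = Pi.single i ((N : ℤ) * σ))
    (v : V) : criticalProb G v < 1 ∧ theta G v (criticalProbIOf G v) = 0 := by
  refine ⟨?_, criticalContinuity_of_finite_orbits hact hc reps htrans hcover c hstab N hN hlip hstep v⟩
  -- the representative of `t` (any representative would do) carries the rank-two pair of step movers
  obtain ⟨a₀, r₀, hr₀, rfl⟩ := hcover t
  obtain ⟨a, -, -, -, ha⟩ := hstep r₀ hr₀ 0 1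
  obtain ⟨b, -, -, -, hb⟩ := hstep r₀ hr₀ 1 1
  have hstab₀ : ∀ h ∈ MulAction.stabilizer A r₀, c h = 1 := map_stabilizer_eq_one_of_one hact hc c hstab r₀
  refine criticalProb_lt_one_of_finite_orbits hact hc r₀ reps hcover c hstab₀ ⟨a, b, ?_⟩ v
  have hN0 : N ≠ 0 := by omega
  rw [ha, hb, Units.val_one, mul_one, MaxArea.det2]
  simp [hN0]

/-- **The same-`p` drop on this class**: every density `p` with `θ_v(p) > 0` admits `q < p` with `θ_v(q) > 0` (no uniqueness, Φ2 or `p < 1` hypothesis).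
builds on p205010 (kernel theorem, internal audit signed; external expert review pending). [cite: BenjaminiSchramm1996, Conj. 4] [cite: KozmaNitzan2024, §1 p. 2] -/
theorem drop_of_finite_orbits (hact : IsActionByAut G A) (hc : G.Connected) (reps : Finset V)
    (htrans : ∀ r ∈ reps, ∀ r' ∈ reps, ∀ a : A, a • r = r' → r = r') (hcover : ∀ w : V, ∃ a : A, ∃ r ∈ reps, a • r = w)
    (c : A →* Multiplicative (Site 2)) {t : V} (hstab : ∀ h ∈ MulAction.stabilizer A t, c h = 1) (N : ℕ) (hN : 1 ≤ N)
    (hlip : ∀ r ∈ reps, ∀ r' ∈ reps, ∀ a : A, G.Adj r (a • r') → ∀ i : Fin 2, |Multiplicative.toAdd (c a) i| ≤ N)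
    (hstep : ∀ r ∈ reps, ∀ (i : Fin 2) (σ : ℤˣ), ∃ (a : A) (r' : V), r' ∈ reps ∧ G.Adj r (a • r') ∧
      Multiplicative.toAdd (c a) = Pi.single i ((N : ℤ) * σ))
    (v : V) (p : unitInterval) (hθ : 0 < theta G v p) : ∃ q : unitInterval, (q : ℝ) < p ∧ 0 < theta G v q := by
  haveI : Countable V := countable_of_connected_of_locallyFinite G hc v
  exact drop_at_of_critical G v (P := fun _ => True)
    (fun _ => criticalContinuity_of_finite_orbits hact hc reps htrans hcover c hstab N hN hlip hstep v) p trivial hθ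

/-! ## §4 The max-area form: steps along an independent pair of character values, all edge values in its parallelogram -/

/-- The re-basing map on `ℤ²` as a monoid homomorphism of `Multiplicative ℤ²`. [folklore] -/
def rebaseHom (u w : Site 2) : Multiplicative (Site 2) →* Multiplicative (Site 2) :=
  AddMonoidHom.toMultiplicative
    { toFun := MaxArea.rebase u w
      map_zero' := MaxArea.rebase_zero u w
      map_add' := MaxArea.rebase_add u w }

/-- `toAdd (rebaseHom u w x) = rebase u w (toAdd x)`. [folklore] -/
@[simp] theorem toAdd_rebaseHom (u w : Site 2) (x : Multiplicative (Site 2)) :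
    Multiplicative.toAdd (rebaseHom u w x) = MaxArea.rebase u w (Multiplicative.toAdd x) := rfl

/-- **THEOREM (max-area form, UNCONDITIONAL)**: instead of a scale `N` and axis values, the customer gives an INDEPENDENT pair `b 0, b 1 ∈ ℤ²` such that
every representative has neighbours `a • r'` with `c a = ± b i` (`i = 0, 1`) and every edge value `c a` (`r ∼ a • r'`) lies in the closed parallelogram
`|det(c a, b 1)|, |det(b 0, c a)| ≤ |det(b 0, b 1)|`; re-basing `c` on `(b 0, b 1)` (p4-g16's `MaxArea.rebase`: `b i ↦ N eᵢ`, `N = |det(b 0, b 1)|`, the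
parallelogram ↦ the sup-norm ball of radius `N`) this is `criticalContinuity_of_finite_orbits`. builds on p205010 (kernel theorem, internal audit signed;
external expert review pending). [cite: BenjaminiSchramm1996, Conj. 4; §2] [cite: KozmaNitzan2024, §4 p. 16 (Lemma 8)] [cite: MartineauTassion2017, §3.2] -/
theorem criticalContinuity_of_finite_orbits_maxArea (hact : IsActionByAut G A) (hc : G.Connected) (reps : Finset V)
    (htrans : ∀ r ∈ reps, ∀ r' ∈ reps, ∀ a : A, a • r = r' → r = r') (hcover : ∀ w : V, ∃ a : A, ∃ r ∈ reps, a • r = w)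
    (c : A →* Multiplicative (Site 2)) {t : V} (hstab : ∀ h ∈ MulAction.stabilizer A t, c h = 1) (b : Fin 2 → Site 2)
    (hb : MaxArea.det2 (b 0) (b 1) ≠ 0)
    (hlip : ∀ r ∈ reps, ∀ r' ∈ reps, ∀ a : A, G.Adj r (a • r') →
      |MaxArea.det2 (Multiplicative.toAdd (c a)) (b 1)| ≤ |MaxArea.det2 (b 0) (b 1)| ∧
        |MaxArea.det2 (b 0) (Multiplicative.toAdd (c a))| ≤ |MaxArea.det2 (b 0) (b 1)|)
    (hstep : ∀ r ∈ reps, ∀ (i : Fin 2) (σ : ℤˣ), ∃ (a : A) (r' : V), r' ∈ reps ∧ G.Adj r (a • r') ∧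
      Multiplicative.toAdd (c a) = (σ : ℤ) • b i)
    (v : V) : theta G v (criticalProbIOf G v) = 0 := by
  set c' : A →* Multiplicative (Site 2) := (rebaseHom (b 0) (b 1)).comp c with hc'
  have hstab' : ∀ h ∈ MulAction.stabilizer A t, c' h = 1 := fun h hh => by
    rw [hc', MonoidHom.comp_apply, hstab h hh, map_one]
  refine criticalContinuity_of_finite_orbits hact hc reps htrans hcover c' hstab' (MaxArea.det2 (b 0) (b 1)).natAbs (Int.natAbs_pos.2 hb)
    (fun r hr r' hr' a ha i => ?_) (fun r hr i σ => ?_) v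
  · rw [hc', MonoidHom.comp_apply, toAdd_rebaseHom, Int.natCast_natAbs]
    exact MaxArea.abs_rebase_le (hlip r hr r' hr' a ha).1 (hlip r hr r' hr' a ha).2 i
  · obtain ⟨a, r', hr', hadj, ha⟩ := hstep r hr i σ
    refine ⟨a, r', hr', hadj, ?_⟩
    rw [hc', MonoidHom.comp_apply, toAdd_rebaseHom, ha, Int.natCast_natAbs]
    rcases Int.units_eq_one_or σ with rfl | rfl
    · rw [Units.val_one, one_smul, mul_one]
      fin_cases i
      · exact MaxArea.rebase_left (b 0) (b 1)
      · exact MaxArea.rebase_right (b 0) (b 1)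
    · rw [Units.val_neg, Units.val_one, neg_smul, one_smul, MaxArea.rebase_neg, mul_neg, mul_one, Pi.single_neg]
      fin_cases i
      · exact congrArg Neg.neg (MaxArea.rebase_left (b 0) (b 1))
      · exact congrArg Neg.neg (MaxArea.rebase_right (b 0) (b 1))

/-! ## §5 The chart form: a chart translated by a group of automorphisms with finitely many orbits, constant on a transversal -/

/-- **THEOREM (chart form, UNCONDITIONAL)**: a connected locally finite graph with a chart `φ : V → ℤ²` TRANSLATED by a group of automorphisms acting with
FINITELY MANY ORBITS (`φ (a • w) − φ w` independent of `w`), taking ONE common value on a transversal `reps`, with `‖φ w − φ r‖_∞ ≤ N` along the edges at the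
representatives and the four exact steps `φ w = φ r ± N eᵢ` along single edges at every representative, has `θ_v(p_c) = 0` at every vertex — NO stabiliser,
growth, cylinder or uniqueness hypothesis (the character `a ↦ φ (a • t) − φ t` kills every stabiliser by itself). [cite: BenjaminiSchramm1996, Conj. 4; §2]
[cite: KozmaNitzan2024, §4 p. 16 (Lemma 8)] -/
theorem criticalContinuity_of_chart_finite_orbits (hact : IsActionByAut G A) (hc : G.Connected) (reps : Finset V)
    (htrans : ∀ r ∈ reps, ∀ r' ∈ reps, ∀ a : A, a • r = r' → r = r') (hcover : ∀ w : V, ∃ a : A, ∃ r ∈ reps, a • r = w)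
    (φ : V → Site 2) {t : V} (hφ : ∀ (a : A) (w : V), φ (a • w) = φ w + (φ (a • t) - φ t)) (hal : ∀ r ∈ reps, ∀ r' ∈ reps, φ r = φ r')
    (N : ℕ) (hN : 1 ≤ N) (hlip : ∀ r ∈ reps, ∀ w : V, G.Adj r w → ∀ i : Fin 2, |φ w i - φ r i| ≤ N)
    (hstep : ∀ r ∈ reps, ∀ (i : Fin 2) (σ : ℤˣ), ∃ w : V, G.Adj r w ∧ φ w = φ r + Pi.single i ((N : ℤ) * σ))
    (v : V) : theta G v (criticalProbIOf G v) = 0 := by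
  -- the character of the chart; on an edge `r ∼ a • r'` its value is `φ (a • r') − φ r`
  have hval : ∀ (a : A), ∀ r ∈ reps, ∀ r' ∈ reps, Multiplicative.toAdd (chartHom t φ hφ a) = φ (a • r') - φ r := by
    intro a r hr r' hr'
    rw [toAdd_chartHom, hφ a r', hal r' hr' r hr]
    abel
  refine criticalContinuity_of_finite_orbits hact hc reps htrans hcover (chartHom t φ hφ) (t := t) (fun h hh => ?_) N hN
    (fun r hr r' hr' a ha i => ?_) (fun r hr i σ => ?_) v
  · show Multiplicative.ofAdd (φ (h • t) - φ t) = 1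
    rw [MulAction.mem_stabilizer_iff.1 hh, sub_self, ofAdd_zero]
  · rw [hval a r hr r' hr', Pi.sub_apply]
    exact hlip r hr _ ha i
  · obtain ⟨w, hw, hφw⟩ := hstep r hr i σ
    obtain ⟨a, r', hr', rfl⟩ := hcover w
    exact ⟨a, r', hr', hw, by rw [hval a r hr r' hr', hφw, add_sub_cancel_left]⟩

/-- **THEOREM (subgroups of `Aut(G)` with finitely many orbits, UNCONDITIONAL)**: a connected locally finite graph with a subgroup `A ≤ Aut(G)` acting with
finitely many orbits (transversal `reps`) and a chart `φ : V → ℤ²` translated by `A`, constant on `reps`, with `N`-range and exact `N`-steps along single edges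
at the representatives, has `θ_v(p_c) = 0` at every vertex. [cite: BenjaminiSchramm1996, Conj. 4; §2] -/
theorem criticalContinuity_of_autSubgroup_finite_orbits (hc : G.Connected) (A : Subgroup (G ≃g G)) (reps : Finset V)
    (htrans : ∀ r ∈ reps, ∀ r' ∈ reps, ∀ α ∈ A, α r = r' → r = r') (hcover : ∀ w : V, ∃ α ∈ A, ∃ r ∈ reps, α r = w)
    (φ : V → Site 2) {t : V} (hφ : ∀ α ∈ A, ∀ w : V, φ (α w) = φ w + (φ (α t) - φ t)) (hal : ∀ r ∈ reps, ∀ r' ∈ reps, φ r = φ r')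
    (N : ℕ) (hN : 1 ≤ N) (hlip : ∀ r ∈ reps, ∀ w : V, G.Adj r w → ∀ i : Fin 2, |φ w i - φ r i| ≤ N)
    (hstep : ∀ r ∈ reps, ∀ (i : Fin 2) (σ : ℤˣ), ∃ w : V, G.Adj r w ∧ φ w = φ r + Pi.single i ((N : ℤ) * σ))
    (v : V) : theta G v (criticalProbIOf G v) = 0 := by
  letI : MulAction (G ≃g G) V := autMulAction G
  have hact : IsActionByAut G A := fun a x y => (a : G ≃g G).map_rel_iff'
  exact criticalContinuity_of_chart_finite_orbits hact hc reps (fun r hr r' hr' a ha => htrans r hr r' hr' a a.2 ha)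
    (fun w => by obtain ⟨α, hα, r, hr, hw⟩ := hcover w; exact ⟨⟨α, hα⟩, r, hr, hw⟩) φ (t := t) (fun a w => hφ a a.2 w) hal N hN hlip hstep v

/-! ## §6 (append 2026-08-27, p3 g28) Conj. 4 in its own shape for the chart forms: `p_c < 1 ∧ θ_v(p_c) = 0` -/

/-- **Conj. 4 in its own shape, chart form (UNCONDITIONAL)**: under the hypotheses of `criticalContinuity_of_chart_finite_orbits` (a chart translated by a group of
automorphisms with finitely many orbits, constant on a transversal, `N`-range and exact `± N eᵢ` single-edge steps at the representatives), `p_c(G) < 1` AND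
`θ_v(p_c) = 0` at every vertex (`conj4_of_finite_orbits` on the character of the chart, which kills every stabiliser by itself).
builds on p205010 (kernel theorem, internal audit signed; external expert review pending). [cite: BenjaminiSchramm1996, Conj. 4; §2 Conj. 1] -/
theorem conj4_of_chart_finite_orbits (hact : IsActionByAut G A) (hc : G.Connected) (reps : Finset V)
    (htrans : ∀ r ∈ reps, ∀ r' ∈ reps, ∀ a : A, a • r = r' → r = r') (hcover : ∀ w : V, ∃ a : A, ∃ r ∈ reps, a • r = w)
    (φ : V → Site 2) {t : V} (hφ : ∀ (a : A) (w : V), φ (a • w) = φ w + (φ (a • t) - φ t)) (hal : ∀ r ∈ reps, ∀ r' ∈ reps, φ r = φ r')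
    (N : ℕ) (hN : 1 ≤ N) (hlip : ∀ r ∈ reps, ∀ w : V, G.Adj r w → ∀ i : Fin 2, |φ w i - φ r i| ≤ N)
    (hstep : ∀ r ∈ reps, ∀ (i : Fin 2) (σ : ℤˣ), ∃ w : V, G.Adj r w ∧ φ w = φ r + Pi.single i ((N : ℤ) * σ))
    (v : V) : criticalProb G v < 1 ∧ theta G v (criticalProbIOf G v) = 0 := by
  have hval : ∀ (a : A), ∀ r ∈ reps, ∀ r' ∈ reps, Multiplicative.toAdd (chartHom t φ hφ a) = φ (a • r') - φ r := by
    intro a r hr r' hr'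
    rw [toAdd_chartHom, hφ a r', hal r' hr' r hr]
    abel
  refine conj4_of_finite_orbits hact hc reps htrans hcover (chartHom t φ hφ) (t := t) (fun h hh => ?_) N hN
    (fun r hr r' hr' a ha i => ?_) (fun r hr i σ => ?_) v
  · show Multiplicative.ofAdd (φ (h • t) - φ t) = 1
    rw [MulAction.mem_stabilizer_iff.1 hh, sub_self, ofAdd_zero]
  · rw [hval a r hr r' hr', Pi.sub_apply]
    exact hlip r hr _ ha i
  · obtain ⟨w, hw, hφw⟩ := hstep r hr i σ
    obtain ⟨a, r', hr', rfl⟩ := hcover w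
    exact ⟨a, r', hr', hw, by rw [hval a r hr r' hr', hφw, add_sub_cancel_left]⟩

/-- **Conj. 4 in its own shape for subgroups of `Aut(G)` with finitely many orbits (UNCONDITIONAL)**: `p_c(G) < 1 ∧ θ_v(p_c) = 0` under the hypotheses of
`criticalContinuity_of_autSubgroup_finite_orbits`. builds on p205010 (kernel theorem, internal audit signed; external expert review pending).
[cite: BenjaminiSchramm1996, Conj. 4; §2 Conj. 1] -/
theorem conj4_of_autSubgroup_finite_orbits (hc : G.Connected) (A : Subgroup (G ≃g G)) (reps : Finset V)
    (htrans : ∀ r ∈ reps, ∀ r' ∈ reps, ∀ α ∈ A, α r = r' → r = r') (hcover : ∀ w : V, ∃ α ∈ A, ∃ r ∈ reps, α r = w)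
    (φ : V → Site 2) {t : V} (hφ : ∀ α ∈ A, ∀ w : V, φ (α w) = φ w + (φ (α t) - φ t)) (hal : ∀ r ∈ reps, ∀ r' ∈ reps, φ r = φ r')
    (N : ℕ) (hN : 1 ≤ N) (hlip : ∀ r ∈ reps, ∀ w : V, G.Adj r w → ∀ i : Fin 2, |φ w i - φ r i| ≤ N)
    (hstep : ∀ r ∈ reps, ∀ (i : Fin 2) (σ : ℤˣ), ∃ w : V, G.Adj r w ∧ φ w = φ r + Pi.single i ((N : ℤ) * σ))
    (v : V) : criticalProb G v < 1 ∧ theta G v (criticalProbIOf G v) = 0 := by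
  letI : MulAction (G ≃g G) V := autMulAction G
  have hact : IsActionByAut G A := fun a x y => (a : G ≃g G).map_rel_iff'
  exact conj4_of_chart_finite_orbits hact hc reps (fun r hr r' hr' a ha => htrans r hr r' hr' a a.2 ha)
    (fun w => by obtain ⟨α, hα, r, hr, hw⟩ := hcover w; exact ⟨⟨α, hα⟩, r, hr, hw⟩) φ (t := t) (fun a w => hφ a a.2 w) hal N hN hlip hstep v

end AutChart

end Summit.CriticalPhenomena.PercolationContinuityZ3.Theorems.Transplant

end
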